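import Literature.MathematicalPhysics.QuantumFieldTheory.Balaban1983to89.AveragingRT
import Literature.MathematicalPhysics.QuantumFieldTheory.Balaban1983to89.MissingProofs

/-!
# Lane `pub-balaban3d` (Bałaban CMP 102, d = 3 UV stability AS PRINTED) — carrier layer p1, part 1 (`Carriers.RT`):
# the renormalization transformation `T` of (2) p. 256 / (10) p. 258 as a push-forward density, the iterated densities
# `ρ_k = T^k ρ₀`, and the normalization identity (6) p. 257 `∫dU ρ_k = ∫dU ρ₀ = Z^ε` AS A THEOREM for every `k`

Source spine: T. Bałaban, *Ultraviolet stability of three-dimensional lattice pure gauge field theories*, Commun. Math. Phys.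
**102** (1985) 255–275 [Balaban1985UV3] ([B10]; (2) p. 256 = PDF 2 L11 «ρ_{k+1} = Tρ_k», (6) p. 257 = PDF 3 L11–14
«∫dUρ_k = ∫dUT^kρ₀ = ∫dUρ₀ = Z^ε»); the transformation `T` is [4] = T. Bałaban, CMP **98** (1985) 17–51
[Balaban1985Averaging] (10) p. 19 «ρ′(V) = ∫dU δ(VŪ^{−1}) ρ(U)» over an averaging operation `U ↦ Ū` ((15) p. 19).

DESIGN DECISION D-1 of the lane (PLAN.md §3.3; owner p1).  The tree reads (10) as the push-forward identity
`Setup.IsRT avg ρ ρ'` («∫dV ρ′(V) f(V) = ∫dU ρ(U) f(Ū)» for bounded measurable `f`; cell pub-balaban DIVERGENCE F7) and asks it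
only of integrable densities (`Setup.RTOpI`, vacuity lesson G-f1-3).  This file discharges the three obligations D-1a/b/c AT THE
LEVEL OF THE TREE VOCABULARY `…Balaban1983to89.Setup` (so that it checks independently of the spine file `…Balaban1985CMP102.Setting`,
whose `RunObjects.T`/`RunObjects.rho` it instantiates in the sibling `Carriers.Run`):
* D-1a EXISTENCE.  `AveragingRT.rnTransport avg ρ` (the Radon–Nikodym derivative `d(Ū_*(ρ dU))/dV`) IS a renormalization
  transform of every integrable `ρ` as soon as the averaging is measurable and the push-forward of the product Haar measure is
  ABSOLUTELY CONTINUOUS, `Ū_*(dU) ≪ dV` — predicate `AvgAC` below (the lane's named binder «AvgPushforwardAC»; the tree's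
  `AveragingRT.rtOpIOfCompatible` asked the stronger Haar-compatibility `Ū_*(dU) = dV`).  `AvgAC` is DISCHARGED in the tree for
  the axial average `U(c)` of [4] (15) (= (15) without its `exp[…]` correction factor; `AveragingRT.map_axialAvg`) — see
  `avgAC_stdAvg`; for the full non-linear average (15) (matrix `log`, defined near small fields only) it is NOT IN PRINT and stays
  the binder.
* D-1c NORMALIZATION.  `∫dV (Tρ)(V) = ∫dU ρ(U)` is `IsRT` tested at `f ≡ 1` — AND `Tρ` is again integrable (an RN derivative of a
  finite measure), which is what makes (6) provable for EVERY `k` by induction (`integral_rhoSeq`).  REMARK (finding F-p1-1 of the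
  seat): for an ABSTRACT `T : RTOpI` the identity (6) is NOT derivable beyond `k = 1` — `RTOpI` promises nothing about `Tρ` when it
  is asked about `T(Tρ)` — so (6) is a theorem about the constructed `T`, not about the binder.
* D-1b (the gauge-fixed form (10) p. 258 of [B10]) is the sibling `Carriers.Formula10`.
HONEST FRAMING (PLAN §0): nothing of CMP 102 is claimed here; every statement is standard measure theory ([folklore]) about the
tree's objects; `d = 3` plays no role in this file (the vocabulary is d-parametric).
-/

open scoped BigOperators ENNReal
open MeasureTheory

namespace Summit.QuantumFields.Balaban3D.Carriers

open Literature.MathematicalPhysics.QuantumFieldTheory.Balaban1983to89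
open Literature.MathematicalPhysics.QuantumFieldTheory.Balaban1983to89.AveragingRT

/-! ## §1 The absolute-continuity hypothesis on an averaging operation (lane binder «AvgPushforwardAC», PLAN §3.3 D-1a) -/

section AC

variable {P : Params} {j : ℕ} {G : Type*} [GaugeGroup G] [MeasurableSpace G] [HaarData G]

/-- `AvgAC avg`: the averaging map `U ↦ Ū` ([Balaban1985Averaging] (10)/(15) p. 19) is measurable and pushes the product Haar
measure `dU` of the fine lattice to a measure ABSOLUTELY CONTINUOUS with respect to the product Haar measure `dV` of the coarse
lattice.  This is exactly what makes `(Tρ)(V) = ∫dU δ(VŪ^{−1})ρ(U)` a FUNCTION of `V` (a Radon–Nikodym derivative) for every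
integrable `ρ`; it is the lane's named binder for the printed average (15) and a theorem for the axial average (`avgAC_stdAvg`). [folklore] -/
def AvgAC (avg : GaugeField P j G → GaugeField P (j+1) G) : Prop :=
  Measurable avg ∧ (fieldMeasure P j G).map avg ≪ fieldMeasure P (j+1) G

/-- `AvgAC`: the averaging is measurable. [folklore] -/
theorem AvgAC.measurable {avg : GaugeField P j G → GaugeField P (j+1) G} (h : AvgAC avg) : Measurable avg := h.1

/-- `AvgAC`: `Ū_*(dU) ≪ dV`. [folklore] -/
theorem AvgAC.ac {avg : GaugeField P j G → GaugeField P (j+1) G} (h : AvgAC avg) :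
    (fieldMeasure P j G).map avg ≪ fieldMeasure P (j+1) G := h.2

/-- Haar-compatibility `Ū_*(dU) = dV` (the hypothesis of `AveragingRT.rtOpIOfCompatible`) implies `AvgAC`. [folklore] -/
theorem AvgAC.of_map_eq {avg : GaugeField P j G → GaugeField P (j+1) G} (havg : Measurable avg)
    (hmap : (fieldMeasure P j G).map avg = fieldMeasure P (j+1) G) : AvgAC avg :=
  ⟨havg, hmap ▸ Measure.AbsolutelyContinuous.rfl⟩

end AC

/-! ## §2 The Radon–Nikodym transport under absolute continuity (D-1a) and its integral (D-1c) -/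

section Transport

variable {P : Params} {j : ℕ} {G : Type*} [GaugeGroup G] [MeasurableSpace G] [HaarData G]

/-- The Radon–Nikodym identity of `AveragingRT.integral_rnDensity_mul` under the WEAKER hypothesis `AvgAC`:
`∫dV (dŪ_*(φ⁺dU)/dV)(V) f(V) = ∫dU φ⁺(U) f(Ū)` for integrable `φ` and bounded measurable `f`. [folklore] -/
theorem integral_rnDensity_mul_of_ac {avg : GaugeField P j G → GaugeField P (j+1) G} (h : AvgAC avg)
    (φ : Density P j G) (hφ : Integrable φ (fieldMeasure P j G))
    (f : GaugeField P (j+1) G → ℝ) (hf : Measurable f) (C : ℝ) (hC : ∀ V, |f V| ≤ C) :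
    Integrable (fun V => rnDensity avg φ V * f V) (fieldMeasure P (j+1) G) ∧
      ∫ V, rnDensity avg φ V * f V ∂(fieldMeasure P (j+1) G)
        = ∫ U, max (φ U) 0 * f (avg U) ∂(fieldMeasure P j G) := by
  haveI : IsFiniteMeasure ((fieldMeasure P j G).withDensity fun U => ENNReal.ofReal (φ U)) :=
    isFiniteMeasure_withDensity_ofReal hφ.hasFiniteIntegral
  haveI : IsFiniteMeasure (pushDensity avg φ) := by unfold pushDensity; infer_instance
  have hac : pushDensity avg φ ≪ fieldMeasure P (j+1) G := by
    have := (withDensity_absolutelyContinuous (fieldMeasure P j G) (fun U => ENNReal.ofReal (φ U))).map h.measurable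
    exact this.trans h.ac
  have hfi : Integrable f (pushDensity avg φ) := integrable_of_abs_le hf C hC
  refine ⟨(integrable_toReal_rnDeriv_mul_iff hac).mpr hfi, ?_⟩
  show ∫ V, ((pushDensity avg φ).rnDeriv (fieldMeasure P (j+1) G) V).toReal * f V ∂(fieldMeasure P (j+1) G) = _
  rw [integral_toReal_rnDeriv_mul hac]
  unfold pushDensity
  rw [integral_map h.measurable.aemeasurable hf.aestronglyMeasurable,
    integral_withDensity_eq_integral_toReal_smul₀ hφ.aemeasurable.ennreal_ofReal
      (Filter.Eventually.of_forall fun _ => ENNReal.ofReal_lt_top)]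
  simp only [ENNReal.toReal_ofReal', smul_eq_mul]

/-- D-1a: under `AvgAC`, `AveragingRT.rnTransport avg ρ` IS a renormalization transform ([Balaban1985Averaging] (10) in the
push-forward reading `Setup.IsRT`) of every integrable density `ρ`. [folklore] -/
theorem isRT_rnTransport_of_ac {avg : GaugeField P j G → GaugeField P (j+1) G} (h : AvgAC avg)
    (ρ : Density P j G) (hρ : Integrable ρ (fieldMeasure P j G)) : IsRT avg ρ (rnTransport avg ρ) := by
  intro f hf hfC
  obtain ⟨C, hC⟩ := hfC
  have hp := integral_rnDensity_mul_of_ac h ρ hρ f hf C hC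
  have hn := integral_rnDensity_mul_of_ac h (fun U => - ρ U) hρ.neg f hf C hC
  have hfb : ∀ U, ‖f (avg U)‖ ≤ C := fun U => by simpa [Real.norm_eq_abs] using hC (avg U)
  have I1 : Integrable (fun U => max (ρ U) 0 * f (avg U)) (fieldMeasure P j G) :=
    hρ.pos_part.mul_bdd (hf.comp h.measurable).aestronglyMeasurable (Filter.Eventually.of_forall hfb)
  have I2 : Integrable (fun U => max (- ρ U) 0 * f (avg U)) (fieldMeasure P j G) :=
    hρ.neg_part.mul_bdd (hf.comp h.measurable).aestronglyMeasurable (Filter.Eventually.of_forall hfb)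
  by_cases h0 : ∀ U, 0 ≤ ρ U
  · simp only [rnTransport, if_pos h0]
    rw [hp.2]
    congr 1
    funext U
    rw [max_eq_left (h0 U)]
  · simp only [rnTransport, if_neg h0, sub_mul]
    rw [integral_sub hp.1 hn.1, hp.2, hn.2, ← integral_sub I1 I2]
    congr 1
    funext U
    rw [← sub_mul, max_zero_sub_max_neg_zero_eq_self]

/-- The RN density of an integrable `φ` is integrable on the coarse lattice (RN derivative of a FINITE measure) — no hypothesis
on the averaging is needed. [folklore] -/
theorem integrable_rnDensity (avg : GaugeField P j G → GaugeField P (j+1) G) (φ : Density P j G)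
    (hφ : Integrable φ (fieldMeasure P j G)) : Integrable (rnDensity avg φ) (fieldMeasure P (j+1) G) := by
  haveI : IsFiniteMeasure ((fieldMeasure P j G).withDensity fun U => ENNReal.ofReal (φ U)) :=
    isFiniteMeasure_withDensity_ofReal hφ.hasFiniteIntegral
  haveI : IsFiniteMeasure (pushDensity avg φ) := by unfold pushDensity; infer_instance
  exact Measure.integrable_toReal_rnDeriv

/-- `Tρ = rnTransport avg ρ` of an integrable `ρ` is integrable (the point of D-1c: the iteration `ρ_{k+1} = Tρ_k` never leaves
the integrable densities). [folklore] -/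
theorem integrable_rnTransport (avg : GaugeField P j G → GaugeField P (j+1) G) (ρ : Density P j G)
    (hρ : Integrable ρ (fieldMeasure P j G)) : Integrable (rnTransport avg ρ) (fieldMeasure P (j+1) G) := by
  by_cases h0 : ∀ U, 0 ≤ ρ U
  · have : rnTransport avg ρ = rnDensity avg ρ := funext fun V => by simp only [rnTransport, if_pos h0]
    rw [this]; exact integrable_rnDensity avg ρ hρ
  · have : rnTransport avg ρ = fun V => rnDensity avg ρ V - rnDensity avg (fun U => - ρ U) V :=
      funext fun V => by simp only [rnTransport, if_neg h0]
    rw [this]; exact (integrable_rnDensity avg ρ hρ).sub (integrable_rnDensity avg _ hρ.neg)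

/-- The RN density is a measurable function of the coarse field. [folklore] -/
theorem measurable_rnDensity (avg : GaugeField P j G → GaugeField P (j+1) G) (φ : Density P j G) :
    Measurable (rnDensity avg φ) :=
  (Measure.measurable_rnDeriv _ _).ennreal_toReal

/-- `Tρ = rnTransport avg ρ` is measurable. [folklore] -/
theorem measurable_rnTransport (avg : GaugeField P j G → GaugeField P (j+1) G) (ρ : Density P j G) :
    Measurable (rnTransport avg ρ) := by
  by_cases h0 : ∀ U, 0 ≤ ρ U
  · have : rnTransport avg ρ = rnDensity avg ρ := funext fun V => by simp only [rnTransport, if_pos h0]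
    rw [this]; exact measurable_rnDensity avg ρ
  · have : rnTransport avg ρ = fun V => rnDensity avg ρ V - rnDensity avg (fun U => - ρ U) V :=
      funext fun V => by simp only [rnTransport, if_neg h0]
    rw [this]; exact (measurable_rnDensity avg ρ).sub (measurable_rnDensity avg _)

/-- The push-forward identity tested at `f ≡ 1`: a renormalization transform preserves the integral of the density
([Balaban1985UV3] (6) p. 257 «∫dU Tρ = ∫dU ρ»; [Balaban1985Averaging] (10)). [folklore] -/
theorem integral_eq_of_isRT {avg : GaugeField P j G → GaugeField P (j+1) G} {ρ : Density P j G}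
    {ρ' : Density P (j+1) G} (h : IsRT avg ρ ρ') :
    ∫ V, ρ' V ∂(fieldMeasure P (j+1) G) = ∫ U, ρ U ∂(fieldMeasure P j G) := by
  have h1 := h (fun _ => (1 : ℝ)) measurable_const ⟨1, fun _ => by simp⟩
  simpa using h1

/-- The RN transport depends only on the dU-a.e. CLASS of a non-negative density (the push-forward of `ρ·dU` does): a.e.-equal non-negative
densities have the SAME transport, pointwise (same measure, same chosen RN version). [folklore] -/
theorem rnTransport_congr_ae {avg : GaugeField P j G → GaugeField P (j+1) G} {ρ ρ' : Density P j G}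
    (h : ρ =ᵐ[fieldMeasure P j G] ρ') (h0 : ∀ U, 0 ≤ ρ U) (h0' : ∀ U, 0 ≤ ρ' U) :
    rnTransport avg ρ = rnTransport avg ρ' := by
  have hae : (fun U => ENNReal.ofReal (ρ U)) =ᵐ[fieldMeasure P j G] fun U => ENNReal.ofReal (ρ' U) :=
    h.mono fun U hU => by simp only [hU]
  have hpd : pushDensity avg ρ = pushDensity avg ρ' := by
    unfold pushDensity
    rw [withDensity_congr_ae hae]
  funext V
  simp only [rnTransport, if_pos h0, if_pos h0', rnDensity, hpd]

/-- D-1c for the constructed `T`: `∫dV (Tρ)(V) = ∫dU ρ(U)` for integrable `ρ` under `AvgAC`. [folklore] -/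
theorem integral_rnTransport_of_ac {avg : GaugeField P j G → GaugeField P (j+1) G} (h : AvgAC avg)
    (ρ : Density P j G) (hρ : Integrable ρ (fieldMeasure P j G)) :
    ∫ V, rnTransport avg ρ V ∂(fieldMeasure P (j+1) G) = ∫ U, ρ U ∂(fieldMeasure P j G) :=
  integral_eq_of_isRT (isRT_rnTransport_of_ac h ρ hρ)

/- UNIQUENESS a.e. of integrable renormalization transforms of one density is ALREADY in the tree:
`Literature.MathematicalPhysics.QuantumFieldTheory.Balaban1983to89.B12RTGaugeInvariance254.ae_eq_of_isRT` (import that module where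
needed; not restated here — gate dedup). -/

/-- THE RENORMALIZATION TRANSFORMATION AS AN OPERATOR on integrable densities (`Setup.RTOpI`) carried by ANY averaging with the
property `AvgAC` — the lane's construction of the binder `T` of [Balaban1985UV3] (2) p. 256 / [Balaban1985Averaging] (10) p. 19.
[cite: Balaban1985Averaging, (10) p.19] -/
noncomputable def rtOpIOfAC (av : Averaging P j G) (h : AvgAC av.avg) : RTOpI P j G av where
  T := rnTransport av.avg
  isRT := fun ρ hρ => isRT_rnTransport_of_ac h ρ hρ
  pos := fun ρ h0 V => rnTransport_nonneg av.avg ρ h0 V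

/-- The operator of `rtOpIOfAC` is `rnTransport` (unfolding lemma). [folklore] -/
theorem rtOpIOfAC_T (av : Averaging P j G) (h : AvgAC av.avg) : (rtOpIOfAC av h).T = rnTransport av.avg := rfl

end Transport

/-! ## §3 The iterated densities `ρ_k = T^k ρ₀` ([Balaban1985UV3] (2) p. 256) and (6) p. 257 for every `k` -/

section Iteration

variable {P : Params} {G : Type*} [GaugeGroup G] [MeasurableSpace G] [HaarData G]

/-- `ρ_k = T^k ρ₀` ([Balaban1985UV3] (2) p. 256 = PDF 2 L11 «ρ_{k+1} = Tρ_k») with `T` the RN transport over the averaging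
family `av`; total in `k` (print stops at `k = K`, `L^Kε = ε₀`). [cite: Balaban1985UV3, (2) p.256] -/
noncomputable def rhoSeq (av : ∀ j, Averaging P j G) (ρ₀ : Density P 0 G) : (k : ℕ) → Density P k G
  | 0 => ρ₀
  | k + 1 => rnTransport (av k).avg (rhoSeq av ρ₀ k)

variable (av : ∀ j, Averaging P j G) (ρ₀ : Density P 0 G)

/-- `ρ_{k+1} = Tρ_k` (definitional). [cite: Balaban1985UV3, (2) p.256] -/
theorem rhoSeq_succ (k : ℕ) : rhoSeq av ρ₀ (k+1) = rnTransport (av k).avg (rhoSeq av ρ₀ k) := rfl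

/-- `ρ_0 = ρ₀` (definitional). [folklore] -/
theorem rhoSeq_zero : rhoSeq av ρ₀ 0 = ρ₀ := rfl

/-- Every `ρ_k` is integrable if `ρ₀` is (no hypothesis on the averaging). [folklore] -/
theorem integrable_rhoSeq (hρ₀ : Integrable ρ₀ (fieldMeasure P 0 G)) :
    ∀ k, Integrable (rhoSeq av ρ₀ k) (fieldMeasure P k G)
  | 0 => hρ₀
  | k + 1 => integrable_rnTransport _ _ (integrable_rhoSeq hρ₀ k)

/-- Every `ρ_k`, `k ≥ 1`, is measurable; `ρ_0` if `ρ₀` is. [folklore] -/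
theorem measurable_rhoSeq (hρ₀ : Measurable ρ₀) : ∀ k, Measurable (rhoSeq av ρ₀ k)
  | 0 => hρ₀
  | _ + 1 => measurable_rnTransport _ _

/-- Every `ρ_k` is pointwise non-negative if `ρ₀` is (`RTOpI.pos`). [folklore] -/
theorem rhoSeq_nonneg (h0 : ∀ U, 0 ≤ ρ₀ U) : ∀ k V, 0 ≤ rhoSeq av ρ₀ k V
  | 0 => h0
  | k + 1 => fun V => rnTransport_nonneg _ _ (rhoSeq_nonneg h0 k) V

/-- Each step IS a renormalization transform in the push-forward reading, unconditionally in `k` (under `AvgAC` at level `k` and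
integrability of `ρ₀`): `IsRT Ū_k ρ_k ρ_{k+1}`. [cite: Balaban1985Averaging, (10) p.19] -/
theorem isRT_rhoSeq (hρ₀ : Integrable ρ₀ (fieldMeasure P 0 G)) (k : ℕ) (hav : AvgAC (av k).avg) :
    IsRT (av k).avg (rhoSeq av ρ₀ k) (rhoSeq av ρ₀ (k+1)) :=
  isRT_rnTransport_of_ac hav _ (integrable_rhoSeq av ρ₀ hρ₀ k)

/-- **(6)** [Balaban1985UV3] p. 257 = PDF 3 L11–14 «∫dUρ_k = ∫dUT^kρ₀ = ∫dUρ₀ = Z^ε» AS A THEOREM, for EVERY `k` whose preceding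
levels satisfy `AvgAC` (in particular for all `k` when the whole family does). [cite: Balaban1985UV3, (6) p.257] -/
theorem integral_rhoSeq (hρ₀ : Integrable ρ₀ (fieldMeasure P 0 G)) :
    ∀ k, (∀ j, j < k → AvgAC (av j).avg) →
      ∫ V, rhoSeq av ρ₀ k V ∂(fieldMeasure P k G) = ∫ U, ρ₀ U ∂(fieldMeasure P 0 G)
  | 0, _ => rfl
  | k + 1, hav => by
    rw [rhoSeq_succ, integral_rnTransport_of_ac (hav k (Nat.lt_succ_self k)) _ (integrable_rhoSeq av ρ₀ hρ₀ k)]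
    exact integral_rhoSeq hρ₀ k fun j hj => hav j (Nat.lt_succ_of_lt hj)

/-- (6) for the whole tower when every level of the averaging family satisfies `AvgAC`. [cite: Balaban1985UV3, (6) p.257] -/
theorem integral_rhoSeq_of_forall (hρ₀ : Integrable ρ₀ (fieldMeasure P 0 G)) (hav : ∀ j, AvgAC (av j).avg) (k : ℕ) :
    ∫ V, rhoSeq av ρ₀ k V ∂(fieldMeasure P k G) = ∫ U, ρ₀ U ∂(fieldMeasure P 0 G) :=
  integral_rhoSeq av ρ₀ hρ₀ k fun j _ => hav j

end Iteration

/-! ## §4 The Wilson start `ρ₀ = exp[−(1/g₀²)A(U) − E]` ([Balaban1985UV3] (1) p. 256): bounded, measurable, integrable -/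

section WilsonStart

variable {P : Params} {G : Type*} [GaugeGroup G]

/-- **(1)** [Balaban1985UV3] p. 256 = PDF 2 L2–4 «ρ₀(U) = exp[−(1/g₀²)A(U) − E]», `A` = the Wilson action with unit weight
(`Setup.wilsonAction4`; «all the lattices T^{(k)} are unit lattices», p. 256 L12–13), as a density on the finest torus; `g0sq`
stands for `g₀² = g²ε` and `E` for the vacuum-energy constant (both parameters here). [cite: Balaban1985UV3, (1) p.256] -/
noncomputable def wilsonStart (P : Params) (G : Type*) [GaugeGroup G] (g0sq E : ℝ) : Density P 0 G :=
  fun U => Real.exp (-(1 / g0sq) * wilsonAction4 U - E)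

/-- `ρ₀ > 0` pointwise. [folklore] -/
theorem wilsonStart_pos (g0sq E : ℝ) (U : GaugeField P 0 G) : 0 < wilsonStart P G g0sq E U := Real.exp_pos _

/-- `ρ₀ ≤ e^{−E}` pointwise for `g₀² ≥ 0` (the action is non-negative, `Setup.wilsonAction4_nonneg`). [folklore] -/
theorem wilsonStart_le {g0sq : ℝ} (hg : 0 ≤ g0sq) (E : ℝ) (U : GaugeField P 0 G) :
    wilsonStart P G g0sq E U ≤ Real.exp (-E) := by
  unfold wilsonStart
  apply Real.exp_le_exp.mpr
  have h1 : 0 ≤ (1 / g0sq) * wilsonAction4 U := mul_nonneg (by positivity) (wilsonAction4_nonneg U)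
  linarith

variable [MeasurableSpace G] [RegularGaugeGroup G]

/-- `ρ₀` is measurable (for a `RegularGaugeGroup`: measurable group operations and `Re tr`). [folklore] -/
theorem measurable_wilsonStart (g0sq E : ℝ) : Measurable (wilsonStart P G g0sq E) := by
  unfold wilsonStart
  exact (((Missing.measurable_wilsonAction4 RegularGaugeGroup.measurable_reTr).const_mul _).sub_const E).exp

variable [HaarData G]

/-- `ρ₀` is integrable for the product Haar (probability) measure, `g₀² ≥ 0`. [folklore] -/
theorem integrable_wilsonStart {g0sq : ℝ} (hg : 0 ≤ g0sq) (E : ℝ) :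
    Integrable (wilsonStart P G g0sq E) (fieldMeasure P 0 G) :=
  integrable_of_abs_le (measurable_wilsonStart g0sq E) (Real.exp (-E)) fun U => by
    rw [abs_of_pos (wilsonStart_pos g0sq E U)]; exact wilsonStart_le hg E U

/-- **(6) for the Wilson start**, every `k`: `∫dV ρ_k = ∫dU ρ₀ = Z^ε` for `ρ_k = T^kρ₀` over any `AvgAC` averaging family.
[cite: Balaban1985UV3, (6) p.257] -/
theorem integral_rhoSeq_wilsonStart (av : ∀ j, Averaging P j G) (hav : ∀ j, AvgAC (av j).avg) {g0sq : ℝ} (hg : 0 ≤ g0sq)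
    (E : ℝ) (k : ℕ) :
    ∫ V, rhoSeq av (wilsonStart P G g0sq E) k V ∂(fieldMeasure P k G)
      = ∫ U, wilsonStart P G g0sq E U ∂(fieldMeasure P 0 G) :=
  integral_rhoSeq_of_forall av _ (integrable_wilsonStart hg E) hav k

end WilsonStart

/-! ## §5 Non-vacuity: the binder `AvgAC` holds for the tree's total axial averaging family `AveragingRT.stdAvg` -/

section NonVacuity

variable {P : Params} {G : Type*} [GaugeGroup G] [MeasurableSpace G] [HaarData G] [MeasurableMul₂ G]

/-- The axial (decimation) average `Ū(c) = U(Γ_c)` — the factor `U(c)` of [Balaban1985Averaging] (15) — satisfies `AvgAC` in the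
standing range `j + 1 ≤ m + K` (it is even Haar compatible: `AveragingRT.map_axialAvg`). [folklore] -/
theorem avgAC_axial {j : ℕ} (hj : j + 1 ≤ P.m + P.K) : AvgAC (axial : Averaging P j G).avg :=
  AvgAC.of_map_eq (by rw [axial_avg]; exact measurable_axialAvg) (by rw [axial_avg]; exact map_axialAvg hj)

omit [HaarData G] in
/-- The total family `stdAvg` is MEASURABLE at every level. [folklore] -/
theorem stdAvg_measurable (k : ℕ) : Measurable (stdAvg P G k).avg := by
  by_cases hk : k + 1 ≤ P.m + P.K
  · have : (stdAvg P G k).avg = (axial : Averaging P k G).avg := by simp only [stdAvg, dif_pos hk]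
    rw [this, axial_avg]; exact measurable_axialAvg
  · have hk' : P.m + P.K ≤ k := by omega
    have : (stdAvg P G k).avg = transportAvg hk' := by simp only [stdAvg, dif_neg hk]
    rw [this]; exact measurable_transportAvg hk'

/-- The total family `stdAvg` is HAAR-COMPATIBLE at every level: `Ū_*(dU) = dV` (the normalisation «∫dV δ(VŪ⁻¹) = 1» of the
printed transformation, [Balaban1985Averaging] (10) p. 19; LQB `map_axialAvg` in the standing range, `map_transportAvg` beyond). [cite: Balaban1985Averaging, (10) p.19] -/
theorem stdAvg_map (k : ℕ) : (fieldMeasure P k G).map (stdAvg P G k).avg = fieldMeasure P (k + 1) G := by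
  by_cases hk : k + 1 ≤ P.m + P.K
  · have : (stdAvg P G k).avg = (axial : Averaging P k G).avg := by simp only [stdAvg, dif_pos hk]
    rw [this, axial_avg]; exact map_axialAvg hk
  · have hk' : P.m + P.K ≤ k := by omega
    have : (stdAvg P G k).avg = transportAvg hk' := by simp only [stdAvg, dif_neg hk]
    rw [this]; exact map_transportAvg hk'

/-- The total family `stdAvg` (axial in range, a relabelling beyond) satisfies `AvgAC` at EVERY level. [folklore] -/
theorem avgAC_stdAvg (k : ℕ) : AvgAC (stdAvg P G k).avg :=
  AvgAC.of_map_eq (stdAvg_measurable k) (stdAvg_map k)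

end NonVacuity

section Certificate

variable {P : Params} {G : Type*} [GaugeGroup G] [MeasurableSpace G] [HaarData G]

/-- CONSISTENCY CERTIFICATE of the carrier layer: for a regular gauge group the Wilson start iterated over the axial family is a
sequence of non-negative integrable densities all of integral `Z^ε = ∫dU ρ₀` — the hypotheses of §3–§4 are jointly satisfiable.
[folklore] -/
theorem carrier_nonvacuous [RegularGaugeGroup G] {g0sq : ℝ} (hg : 0 ≤ g0sq) (E : ℝ) (k : ℕ) :
    (∀ V, 0 ≤ rhoSeq (stdAvg P G) (wilsonStart P G g0sq E) k V) ∧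
      Integrable (rhoSeq (stdAvg P G) (wilsonStart P G g0sq E) k) (fieldMeasure P k G) ∧
      ∫ V, rhoSeq (stdAvg P G) (wilsonStart P G g0sq E) k V ∂(fieldMeasure P k G)
        = ∫ U, wilsonStart P G g0sq E U ∂(fieldMeasure P 0 G) :=
  ⟨rhoSeq_nonneg _ _ (fun U => (wilsonStart_pos g0sq E U).le) k,
    integrable_rhoSeq _ _ (integrable_wilsonStart hg E) k,
    integral_rhoSeq_wilsonStart _ (avgAC_stdAvg) hg E k⟩

end Certificate

end Summit.QuantumFields.Balaban3D.Carriers
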